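import Literature.Geometry.Lorentzian.CoordCurvatureNormEvolution
import HarnessLib

/-!
# Curvature components on a moving frame: multilinear expansion, time derivative, Leibniz rule

Coordinate tensor calculus (the `MetricCoord` layer over `CoordCurvature.lean` ff.) used by the
proof of Hamilton's maximum principle for the curvature ODE
(`Literature.Geometry.Riemannian.hamilton_maximumPrinciple_curvatureODE`; Hamilton 1986, §4,
Thm. 4.3, with Uhlenbeck's trick of §2): the components `Rm(W_a, W_b, W_c, W_d) =
G(R(W_a,W_b)W_c, W_d)` of the curvature tensor of metric components `G` on a frame `W`, their
expansion in a basis, and — for a smooth one-parameter family `G t` — the derivative of the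
components along a frame `W(t)` moving differentiably in time (Leibniz rule), with the joint
continuity of all the terms. Pure Fréchet calculus on a finite-dimensional real normed space `E`.

* `IsONFrame B W` — `W : ι → E` is orthonormal for the bilinear form `B` (`B(W_i, W_j) = δ_{ij}`);
  `IsONFrame.linearIndependent`, `IsONFrame.norm_le` (frames of a form bounded below by `λ|·|²`
  are bounded by `λ^{-1/2}`), `IsONFrame.toBasis` (when `card ι = dim E`).
* `rmForm G y X Y Z U = G_y(R_y(X,Y)Z, U)` (the tree's `curvatureForm` read in coordinates,
  `chartRep_riemAt_eq_curvatureForm`), its multilinearity and basis expansion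
  (`rmForm_eq_sum`); `rmComp G y W a b c d = rmForm G y (W a) (W b) (W c) (W d)`.
* For a family: `dRmForm G S t y X Y Z U = ∂_t G_t(R_t(X,Y)Z, U)` (derivative within `S`),
  `hasDerivWithinAt_rmForm`, its expansion `dRmForm_eq_sum`, and the **Leibniz rule**
  `hasDerivWithinAt_rmComp_frame`: along a frame `W(s)` with derivative `W'` at `t`,
  `d/ds Rm_s(W_a,W_b,W_c,W_d) = (∂_t Rm)(W_a,…) + Rm(W'_a, W_b, …) + … + Rm(…, W'_d)`
  (Hamilton 1986, §2, p. 157, the computation behind Uhlenbeck's trick).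
* Continuity: `continuousOn_rmForm_family`, `continuousOn_dRmForm_family` (joint continuity in
  `(y, t, X, Y, Z, U)` on `V × S × E⁴`, from the joint smoothness of the family).

Everything is proved; no definition of `Prop` type besides the predicate `IsONFrame`.

## References

* R. S. Hamilton, *Four-manifolds with positive curvature operator*, J. Differential Geom. 24
  (1986) 153–179, §2 (p. 157, Uhlenbeck's trick), §4 (Thm. 4.3). [Hamilton1986]
* P. Topping, *Lectures on the Ricci flow*, LMS Lecture Note Series 325, CUP 2006, §1.2.3
  (smoothness conventions), §2.5 (Prop. 2.5.1). [Topping2006]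
* B. O'Neill, *Semi-Riemannian geometry*, Academic Press 1983, Ch. 3, Lemma 3.35 (`Rm` is a
  tensor). [ONeill1983]
-/

noncomputable section

set_option maxSynthPendingDepth 3

open Set Filter ContinuousLinearMap Module
open scoped Topology ContDiff

namespace Literature.Geometry.Lorentzian

namespace MetricCoord

variable {E : Type*} [NormedAddCommGroup E] [NormedSpace ℝ E]

/-! ### Orthonormal frames of a bilinear form -/

section Frames

variable {ι : Type*} [DecidableEq ι]

/-- `W : ι → E` is an **orthonormal frame** for the bilinear form `B`: `B(W_i, W_j) = δ_{ij}`
(the tree's `PseudoRiemannianMetric.IsOrthonormalFrame` read in coordinates).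
[cite: ONeill1983, Ch. 3, Lemma 3.35] -/
def IsONFrame (B : E →L[ℝ] E →L[ℝ] ℝ) (W : ι → E) : Prop :=
  ∀ i j, B (W i) (W j) = if i = j then 1 else 0

namespace IsONFrame

variable {B : E →L[ℝ] E →L[ℝ] ℝ} {W : ι → E}

/-- Diagonal entries. [folklore] -/
theorem apply_self (h : IsONFrame B W) (i : ι) : B (W i) (W i) = 1 := by
  simpa using h i i

/-- Off-diagonal entries. [folklore] -/
theorem apply_of_ne (h : IsONFrame B W) {i j : ι} (hij : i ≠ j) : B (W i) (W j) = 0 := by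
  simpa [hij] using h i j

/-- An orthonormal frame is linearly independent. [folklore] -/
theorem linearIndependent (h : IsONFrame B W) : LinearIndependent ℝ W := by
  rw [linearIndependent_iff']
  intro s c hc i hi
  have h0 : B (∑ j ∈ s, c j • W j) (W i) = 0 := by rw [hc, map_zero, zero_apply]
  rw [map_sum, sum_apply] at h0
  simp only [map_smul, smul_apply, smul_eq_mul] at h0
  rw [Finset.sum_eq_single i (fun j _ hji ↦ by rw [h.apply_of_ne hji, mul_zero])
    (fun hi' ↦ absurd hi hi')] at h0
  simpa [h.apply_self i] using h0

/-- **Orthonormal frames are bounded**: if `λ ‖v‖² ≤ B(v, v)` for all `v` (`λ > 0`), every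
vector of a `B`-orthonormal frame has norm at most `λ^{-1/2}` — in particular orthonormal frames
of a continuous family of positive definite forms over a compact set are uniformly bounded.
[folklore] -/
theorem norm_le (h : IsONFrame B W) {lam : ℝ} (hlam : 0 < lam)
    (hB : ∀ v : E, lam * ‖v‖ ^ 2 ≤ B v v) (i : ι) : ‖W i‖ ≤ (Real.sqrt lam)⁻¹ := by
  have h1 : lam * ‖W i‖ ^ 2 ≤ 1 := by simpa [h.apply_self i] using hB (W i)
  have h2 : ‖W i‖ ^ 2 ≤ lam⁻¹ := by
    rw [← one_div]
    exact (le_div_iff₀' hlam).2 h1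
  calc ‖W i‖ = Real.sqrt (‖W i‖ ^ 2) := (Real.sqrt_sq (norm_nonneg _)).symm
    _ ≤ Real.sqrt lam⁻¹ := Real.sqrt_le_sqrt h2
    _ = (Real.sqrt lam)⁻¹ := Real.sqrt_inv lam

variable [Fintype ι]

/-- An orthonormal frame with `card ι = dim E` vectors is a basis. [folklore] -/
def toBasis [Nonempty ι] (h : IsONFrame B W) (hcard : Fintype.card ι = finrank ℝ E) :
    Basis ι ℝ E :=
  basisOfLinearIndependentOfCardEqFinrank h.linearIndependent hcard

/-- The basis of an orthonormal frame consists of the frame vectors. [folklore] -/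
@[simp] theorem coe_toBasis [Nonempty ι] (h : IsONFrame B W) (hcard : Fintype.card ι = finrank ℝ E) :
    ⇑(h.toBasis hcard) = W :=
  coe_basisOfLinearIndependentOfCardEqFinrank _ _

/-- The orthonormality relations of the basis of an orthonormal frame (the hypothesis `he` of the
orthonormal-basis lemmas of `CoordCurvatureNormSq.lean`). [folklore] -/
theorem toBasis_orthonormal [Nonempty ι] (h : IsONFrame B W)
    (hcard : Fintype.card ι = finrank ℝ E) (i j : ι) :
    B (h.toBasis hcard i) (h.toBasis hcard j) = if i = j then 1 else 0 := by
  rw [coe_toBasis]; exact h i j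

end IsONFrame

end Frames

/-! ### The curvature form `G(R(X,Y)Z, U)` and its components on a frame -/

section RmForm

variable (G : E → E →L[ℝ] E →L[ℝ] ℝ)

/-- The **curvature form** of metric components at `y`: `Rm_y(X,Y,Z,U) = G_y(R_y(X,Y)Z, U)`
(`R = riemAt`; the tree's `PseudoRiemannianMetric.curvatureForm` read in a chart,
`chartRep_riemAt_eq_curvatureForm`). [cite: ONeill1983, Ch. 3, Lemma 3.35] -/
def rmForm (y X Y Z U : E) : ℝ := G y (riemAt G y X Y Z) U

/-- The **curvature components on a frame**: `r a b c d = Rm_y(W_a, W_b, W_c, W_d)`.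
[cite: ONeill1983, Ch. 3, Lemma 3.35] -/
def rmComp {ι : Type*} (y : E) (W : ι → E) : ι → ι → ι → ι → ℝ :=
  fun a b c d ↦ rmForm G y (W a) (W b) (W c) (W d)

/-- Unfolding lemma for `rmComp`. [folklore] -/
theorem rmComp_apply {ι : Type*} (y : E) (W : ι → E) (a b c d : ι) :
    rmComp G y W a b c d = G y (riemAt G y (W a) (W b) (W c)) (W d) := rfl

/-- `Rm` is additive in the first slot. [folklore] -/
theorem rmForm_add₁ (y X₁ X₂ Y Z U : E) :
    rmForm G y (X₁ + X₂) Y Z U = rmForm G y X₁ Y Z U + rmForm G y X₂ Y Z U := by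
  simp [rmForm, riemAt_add_left]

/-- `Rm` is homogeneous in the first slot. [folklore] -/
theorem rmForm_smul₁ (y : E) (c : ℝ) (X Y Z U : E) :
    rmForm G y (c • X) Y Z U = c * rmForm G y X Y Z U := by
  simp [rmForm, riemAt_smul_left]

/-- `Rm` is additive in the second slot. [folklore] -/
theorem rmForm_add₂ (y X Y₁ Y₂ Z U : E) :
    rmForm G y X (Y₁ + Y₂) Z U = rmForm G y X Y₁ Z U + rmForm G y X Y₂ Z U := by
  simp [rmForm, riemAt_add_right]

/-- `Rm` is homogeneous in the second slot. [folklore] -/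
theorem rmForm_smul₂ (y : E) (c : ℝ) (X Y Z U : E) :
    rmForm G y X (c • Y) Z U = c * rmForm G y X Y Z U := by
  simp [rmForm, riemAt_smul_right]

/-- `Rm` is additive in the third slot. [folklore] -/
theorem rmForm_add₃ (y X Y Z₁ Z₂ U : E) :
    rmForm G y X Y (Z₁ + Z₂) U = rmForm G y X Y Z₁ U + rmForm G y X Y Z₂ U := by
  simp [rmForm]

/-- `Rm` is homogeneous in the third slot. [folklore] -/
theorem rmForm_smul₃ (y : E) (c : ℝ) (X Y Z U : E) :
    rmForm G y X Y (c • Z) U = c * rmForm G y X Y Z U := by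
  simp [rmForm]

/-- `Rm` is additive in the fourth slot. [folklore] -/
theorem rmForm_add₄ (y X Y Z U₁ U₂ : E) :
    rmForm G y X Y Z (U₁ + U₂) = rmForm G y X Y Z U₁ + rmForm G y X Y Z U₂ := by
  simp [rmForm]

/-- `Rm` is homogeneous in the fourth slot. [folklore] -/
theorem rmForm_smul₄ (y : E) (c : ℝ) (X Y Z U : E) :
    rmForm G y X Y Z (c • U) = c * rmForm G y X Y Z U := by
  simp [rmForm]

variable {G}

/-- **Expansion of a `4`-linear real function in a basis**: if `T` is additive and homogeneous in
each of its four arguments, `T(X,Y,Z,U) = Σ_{ijkl} Xⁱ Yʲ Zᵏ Uˡ T(b_i,b_j,b_k,b_l)`. [folklore] -/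
theorem multilinear_eq_sum₄ {ι : Type*} [Fintype ι] (b : Basis ι ℝ E) (T : E → E → E → E → ℝ)
    (ha₁ : ∀ X₁ X₂ Y Z U, T (X₁ + X₂) Y Z U = T X₁ Y Z U + T X₂ Y Z U)
    (hs₁ : ∀ (c : ℝ) X Y Z U, T (c • X) Y Z U = c * T X Y Z U)
    (ha₂ : ∀ X Y₁ Y₂ Z U, T X (Y₁ + Y₂) Z U = T X Y₁ Z U + T X Y₂ Z U)
    (hs₂ : ∀ (c : ℝ) X Y Z U, T X (c • Y) Z U = c * T X Y Z U)
    (ha₃ : ∀ X Y Z₁ Z₂ U, T X Y (Z₁ + Z₂) U = T X Y Z₁ U + T X Y Z₂ U)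
    (hs₃ : ∀ (c : ℝ) X Y Z U, T X Y (c • Z) U = c * T X Y Z U)
    (ha₄ : ∀ X Y Z U₁ U₂, T X Y Z (U₁ + U₂) = T X Y Z U₁ + T X Y Z U₂)
    (hs₄ : ∀ (c : ℝ) X Y Z U, T X Y Z (c • U) = c * T X Y Z U) (X Y Z U : E) :
    T X Y Z U = ∑ i, ∑ j, ∑ k, ∑ l,
      b.coord i X * b.coord j Y * b.coord k Z * b.coord l U * T (b i) (b j) (b k) (b l) := by
  -- linear maps out of each slot, to use `map_sum`
  have hsum₁ : ∀ (s : Finset ι) (f : ι → E) Y Z U, T (∑ i ∈ s, f i) Y Z U = ∑ i ∈ s, T (f i) Y Z U := by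
    intro s f Y Z U
    classical
    induction s using Finset.induction_on with
    | empty => simpa using hs₁ 0 0 Y Z U
    | insert a s ha ih => rw [Finset.sum_insert ha, Finset.sum_insert ha, ha₁, ih]
  have hsum₂ : ∀ (s : Finset ι) (f : ι → E) X Z U, T X (∑ i ∈ s, f i) Z U = ∑ i ∈ s, T X (f i) Z U := by
    intro s f X Z U
    classical
    induction s using Finset.induction_on with
    | empty => simpa using hs₂ 0 X 0 Z U
    | insert a s ha ih => rw [Finset.sum_insert ha, Finset.sum_insert ha, ha₂, ih]
  have hsum₃ : ∀ (s : Finset ι) (f : ι → E) X Y U, T X Y (∑ i ∈ s, f i) U = ∑ i ∈ s, T X Y (f i) U := by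
    intro s f X Y U
    classical
    induction s using Finset.induction_on with
    | empty => simpa using hs₃ 0 X Y 0 U
    | insert a s ha ih => rw [Finset.sum_insert ha, Finset.sum_insert ha, ha₃, ih]
  have hsum₄ : ∀ (s : Finset ι) (f : ι → E) X Y Z, T X Y Z (∑ i ∈ s, f i) = ∑ i ∈ s, T X Y Z (f i) := by
    intro s f X Y Z
    classical
    induction s using Finset.induction_on with
    | empty => simpa using hs₄ 0 X Y Z 0
    | insert a s ha ih => rw [Finset.sum_insert ha, Finset.sum_insert ha, ha₄, ih]
  conv_lhs => rw [← b.sum_repr X, ← b.sum_repr Y, ← b.sum_repr Z, ← b.sum_repr U]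
  rw [hsum₁]
  refine Finset.sum_congr rfl fun i _ ↦ ?_
  rw [hs₁, hsum₂, Finset.mul_sum]
  refine Finset.sum_congr rfl fun j _ ↦ ?_
  rw [hs₂, hsum₃, Finset.mul_sum, Finset.mul_sum]
  refine Finset.sum_congr rfl fun k _ ↦ ?_
  rw [hs₃, hsum₄, Finset.mul_sum, Finset.mul_sum, Finset.mul_sum]
  refine Finset.sum_congr rfl fun l _ ↦ ?_
  rw [hs₄]
  simp only [Basis.coord_apply]
  ring

/-- **Expansion of the curvature form in a basis**:
`Rm(X,Y,Z,U) = Σ_{ijkl} Xⁱ Yʲ Zᵏ Uˡ Rm(b_i,b_j,b_k,b_l)`. [cite: ONeill1983, Ch. 3, Lemma 3.35] -/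
theorem rmForm_eq_sum {ι : Type*} [Fintype ι] (b : Basis ι ℝ E) (y X Y Z U : E) :
    rmForm G y X Y Z U = ∑ i, ∑ j, ∑ k, ∑ l, b.coord i X * b.coord j Y * b.coord k Z * b.coord l U *
      rmForm G y (b i) (b j) (b k) (b l) :=
  multilinear_eq_sum₄ b (rmForm G y) (rmForm_add₁ G y) (rmForm_smul₁ G y) (rmForm_add₂ G y)
    (rmForm_smul₂ G y) (rmForm_add₃ G y) (rmForm_smul₃ G y) (rmForm_add₄ G y) (rmForm_smul₄ G y)
    X Y Z U

variable {V : Set E}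

/-- `y ↦ Rm_y(X,Y,Z,U)` is `C^∞` on `V`. [folklore] -/
theorem IsMetricOn.contDiffOn_rmForm [CompleteSpace E] (hG : IsMetricOn G V) (X Y Z U : E) :
    ContDiffOn ℝ ∞ (fun y ↦ rmForm G y X Y Z U) V :=
  ((hG.contDiffOn.clm_apply (hG.contDiffOn_riemAt_apply X Y Z)).clm_apply contDiffOn_const)

end RmForm

/-! ### Families: the time derivative of the curvature form and the Leibniz rule on a moving frame -/

namespace IsMetricFamilyOn

variable [CompleteSpace E] {G : ℝ → E → E →L[ℝ] E →L[ℝ] ℝ} {S : Set ℝ} {V : Set E} {y : E} {t : ℝ}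

/-- The **time derivative of the curvature form** of a family at fixed vectors, within `S`:
`∂_t Rm(X,Y,Z,U) := d/ds|_{s=t} G_s(R_s(X,Y)Z, U)` (Topping 2006, Prop. 2.5.1 computes it under the
Ricci flow). [cite: Topping2006, Prop. 2.5.1] -/
def _root_.Literature.Geometry.Lorentzian.MetricCoord.dRmForm (G : ℝ → E → E →L[ℝ] E →L[ℝ] ℝ)
    (S : Set ℝ) (t : ℝ) (y X Y Z U : E) : ℝ :=
  derivWithin (fun s ↦ rmForm (G s) y X Y Z U) S t

/-- `s ↦ Rm_s(X,Y,Z,U)` is differentiable within `S` with derivative `dRmForm`. [folklore] -/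
theorem hasDerivWithinAt_rmForm (hG : IsMetricFamilyOn G S V) (hy : y ∈ V) (ht : t ∈ S)
    (X Y Z U : E) :
    HasDerivWithinAt (fun s ↦ rmForm (G s) y X Y Z U) (dRmForm G S t y X Y Z U) S t := by
  have hGx := hG.hasDerivWithinAt hy ht
  have hR := hG.hasDerivWithinAt_riemAt_apply hy ht X Y Z
  have h1 := (hGx.clm_apply hR).clm_apply (hasDerivWithinAt_const t S U)
  exact (h1.differentiableWithinAt.hasDerivWithinAt :)

omit [CompleteSpace E] in
/-- `∂_t Rm` is the derivative of any function agreeing with `s ↦ Rm_s(X,Y,Z,U)`: uniqueness of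
derivatives within `S`. [folklore] -/
theorem dRmForm_eq_of_hasDerivWithinAt (hG : IsMetricFamilyOn G S V) (ht : t ∈ S) {X Y Z U : E}
    {c : ℝ} (h : HasDerivWithinAt (fun s ↦ rmForm (G s) y X Y Z U) c S t) :
    dRmForm G S t y X Y Z U = c :=
  h.derivWithin (hG.uniqueDiffOn t ht)

/-- `∂_t Rm` is additive in the first slot (derivative of a sum). [folklore] -/
theorem dRmForm_add₁ (hG : IsMetricFamilyOn G S V) (hy : y ∈ V) (ht : t ∈ S) (X₁ X₂ Y Z U : E) :
    dRmForm G S t y (X₁ + X₂) Y Z U = dRmForm G S t y X₁ Y Z U + dRmForm G S t y X₂ Y Z U := by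
  refine hG.dRmForm_eq_of_hasDerivWithinAt ht ?_
  have h := (hG.hasDerivWithinAt_rmForm hy ht X₁ Y Z U).add (hG.hasDerivWithinAt_rmForm hy ht X₂ Y Z U)
  exact h.congr (fun s _ ↦ rmForm_add₁ (G s) y X₁ X₂ Y Z U) (rmForm_add₁ (G t) y X₁ X₂ Y Z U)

/-- `∂_t Rm` is homogeneous in the first slot. [folklore] -/
theorem dRmForm_smul₁ (hG : IsMetricFamilyOn G S V) (hy : y ∈ V) (ht : t ∈ S) (c : ℝ) (X Y Z U : E) :
    dRmForm G S t y (c • X) Y Z U = c * dRmForm G S t y X Y Z U := by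
  refine hG.dRmForm_eq_of_hasDerivWithinAt ht ?_
  have h := (hG.hasDerivWithinAt_rmForm hy ht X Y Z U).const_mul c
  exact h.congr (fun s _ ↦ rmForm_smul₁ (G s) y c X Y Z U) (rmForm_smul₁ (G t) y c X Y Z U)

/-- `∂_t Rm` is additive in the second slot. [folklore] -/
theorem dRmForm_add₂ (hG : IsMetricFamilyOn G S V) (hy : y ∈ V) (ht : t ∈ S) (X Y₁ Y₂ Z U : E) :
    dRmForm G S t y X (Y₁ + Y₂) Z U = dRmForm G S t y X Y₁ Z U + dRmForm G S t y X Y₂ Z U := by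
  refine hG.dRmForm_eq_of_hasDerivWithinAt ht ?_
  have h := (hG.hasDerivWithinAt_rmForm hy ht X Y₁ Z U).add (hG.hasDerivWithinAt_rmForm hy ht X Y₂ Z U)
  exact h.congr (fun s _ ↦ rmForm_add₂ (G s) y X Y₁ Y₂ Z U) (rmForm_add₂ (G t) y X Y₁ Y₂ Z U)

/-- `∂_t Rm` is homogeneous in the second slot. [folklore] -/
theorem dRmForm_smul₂ (hG : IsMetricFamilyOn G S V) (hy : y ∈ V) (ht : t ∈ S) (c : ℝ) (X Y Z U : E) :
    dRmForm G S t y X (c • Y) Z U = c * dRmForm G S t y X Y Z U := by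
  refine hG.dRmForm_eq_of_hasDerivWithinAt ht ?_
  have h := (hG.hasDerivWithinAt_rmForm hy ht X Y Z U).const_mul c
  exact h.congr (fun s _ ↦ rmForm_smul₂ (G s) y c X Y Z U) (rmForm_smul₂ (G t) y c X Y Z U)

/-- `∂_t Rm` is additive in the third slot. [folklore] -/
theorem dRmForm_add₃ (hG : IsMetricFamilyOn G S V) (hy : y ∈ V) (ht : t ∈ S) (X Y Z₁ Z₂ U : E) :
    dRmForm G S t y X Y (Z₁ + Z₂) U = dRmForm G S t y X Y Z₁ U + dRmForm G S t y X Y Z₂ U := by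
  refine hG.dRmForm_eq_of_hasDerivWithinAt ht ?_
  have h := (hG.hasDerivWithinAt_rmForm hy ht X Y Z₁ U).add (hG.hasDerivWithinAt_rmForm hy ht X Y Z₂ U)
  exact h.congr (fun s _ ↦ rmForm_add₃ (G s) y X Y Z₁ Z₂ U) (rmForm_add₃ (G t) y X Y Z₁ Z₂ U)

/-- `∂_t Rm` is homogeneous in the third slot. [folklore] -/
theorem dRmForm_smul₃ (hG : IsMetricFamilyOn G S V) (hy : y ∈ V) (ht : t ∈ S) (c : ℝ) (X Y Z U : E) :
    dRmForm G S t y X Y (c • Z) U = c * dRmForm G S t y X Y Z U := by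
  refine hG.dRmForm_eq_of_hasDerivWithinAt ht ?_
  have h := (hG.hasDerivWithinAt_rmForm hy ht X Y Z U).const_mul c
  exact h.congr (fun s _ ↦ rmForm_smul₃ (G s) y c X Y Z U) (rmForm_smul₃ (G t) y c X Y Z U)

/-- `∂_t Rm` is additive in the fourth slot. [folklore] -/
theorem dRmForm_add₄ (hG : IsMetricFamilyOn G S V) (hy : y ∈ V) (ht : t ∈ S) (X Y Z U₁ U₂ : E) :
    dRmForm G S t y X Y Z (U₁ + U₂) = dRmForm G S t y X Y Z U₁ + dRmForm G S t y X Y Z U₂ := by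
  refine hG.dRmForm_eq_of_hasDerivWithinAt ht ?_
  have h := (hG.hasDerivWithinAt_rmForm hy ht X Y Z U₁).add (hG.hasDerivWithinAt_rmForm hy ht X Y Z U₂)
  exact h.congr (fun s _ ↦ rmForm_add₄ (G s) y X Y Z U₁ U₂) (rmForm_add₄ (G t) y X Y Z U₁ U₂)

/-- `∂_t Rm` is homogeneous in the fourth slot. [folklore] -/
theorem dRmForm_smul₄ (hG : IsMetricFamilyOn G S V) (hy : y ∈ V) (ht : t ∈ S) (c : ℝ) (X Y Z U : E) :
    dRmForm G S t y X Y Z (c • U) = c * dRmForm G S t y X Y Z U := by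
  refine hG.dRmForm_eq_of_hasDerivWithinAt ht ?_
  have h := (hG.hasDerivWithinAt_rmForm hy ht X Y Z U).const_mul c
  exact h.congr (fun s _ ↦ rmForm_smul₄ (G s) y c X Y Z U) (rmForm_smul₄ (G t) y c X Y Z U)

/-- **Expansion of `∂_t Rm` in a basis** (it is `4`-linear, being a derivative of `4`-linear
functions). [folklore] -/
theorem dRmForm_eq_sum {ι : Type*} [Fintype ι] (b : Basis ι ℝ E) (hG : IsMetricFamilyOn G S V)
    (hy : y ∈ V) (ht : t ∈ S) (X Y Z U : E) :
    dRmForm G S t y X Y Z U = ∑ i, ∑ j, ∑ k, ∑ l, b.coord i X * b.coord j Y * b.coord k Z *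
      b.coord l U * dRmForm G S t y (b i) (b j) (b k) (b l) :=
  multilinear_eq_sum₄ b (dRmForm G S t y) (hG.dRmForm_add₁ hy ht) (hG.dRmForm_smul₁ hy ht)
    (hG.dRmForm_add₂ hy ht) (hG.dRmForm_smul₂ hy ht) (hG.dRmForm_add₃ hy ht) (hG.dRmForm_smul₃ hy ht)
    (hG.dRmForm_add₄ hy ht) (hG.dRmForm_smul₄ hy ht) X Y Z U

/-- **Leibniz rule for the curvature components on a moving frame** (the computation behind
Uhlenbeck's trick, Hamilton 1986, §2, p. 157). If the family is smooth, `t ∈ S' ⊆ S`, and the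
frame `W : ℝ → ι → E` has derivative `W'` within `S'` at `t` (in the product space `ι → E`), then
`s ↦ Rm_s(W_a(s), W_b(s), W_c(s), W_d(s))` has, within `S'` at `t`, the derivative
`∂_tRm(W_a,W_b,W_c,W_d) + Rm(W'_a,W_b,W_c,W_d) + Rm(W_a,W'_b,W_c,W_d) + Rm(W_a,W_b,W'_c,W_d)
  + Rm(W_a,W_b,W_c,W'_d)` (all at time `t`). [cite: Hamilton1986, §2, p. 157] -/
theorem hasDerivWithinAt_rmComp_frame {ι : Type*} [FiniteDimensional ℝ E] (hG : IsMetricFamilyOn G S V)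
    (hy : y ∈ V) {S' : Set ℝ} (hS' : S' ⊆ S) (ht : t ∈ S') {W : ℝ → ι → E} {W' : ι → E}
    (hW : HasDerivWithinAt W W' S' t) (a b c d : ι) :
    HasDerivWithinAt (fun s ↦ rmComp (G s) y (W s) a b c d)
      (dRmForm G S t y (W t a) (W t b) (W t c) (W t d)
        + rmForm (G t) y (W' a) (W t b) (W t c) (W t d) + rmForm (G t) y (W t a) (W' b) (W t c) (W t d)
        + rmForm (G t) y (W t a) (W t b) (W' c) (W t d) + rmForm (G t) y (W t a) (W t b) (W t c) (W' d))
      S' t := by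
  set bE := Module.finBasis ℝ E
  have htS : t ∈ S := hS' ht
  -- coordinates of the frame vectors and their derivatives
  have hWi : ∀ i : ι, HasDerivWithinAt (fun s ↦ W s i) (W' i) S' t := fun i ↦ by
    have := hasDerivWithinAt_pi.1 hW i
    exact this
  have hco : ∀ (i : ι) (m : Fin (finrank ℝ E)),
      HasDerivWithinAt (fun s ↦ bE.coord m (W s i)) (bE.coord m (W' i)) S' t := fun i m ↦
    ((bE.coord m).toContinuousLinearMap.hasFDerivAt.comp_hasDerivWithinAt t (hWi i) :)
  -- the components at basis vectors
  have hT : ∀ i j k l, HasDerivWithinAt (fun s ↦ rmForm (G s) y (bE i) (bE j) (bE k) (bE l))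
      (dRmForm G S t y (bE i) (bE j) (bE k) (bE l)) S' t := fun i j k l ↦
    (hG.hasDerivWithinAt_rmForm hy htS _ _ _ _).mono hS'
  -- rewrite the function through the expansion and differentiate termwise
  have hfun : (fun s ↦ rmComp (G s) y (W s) a b c d) = fun s ↦ ∑ i, ∑ j, ∑ k, ∑ l,
      bE.coord i (W s a) * bE.coord j (W s b) * bE.coord k (W s c) * bE.coord l (W s d) *
        rmForm (G s) y (bE i) (bE j) (bE k) (bE l) := by
    funext s; exact rmForm_eq_sum bE y _ _ _ _
  rw [hfun]
  have hterm : ∀ i j k l, HasDerivWithinAt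
      (fun s ↦ bE.coord i (W s a) * bE.coord j (W s b) * bE.coord k (W s c) * bE.coord l (W s d) *
        rmForm (G s) y (bE i) (bE j) (bE k) (bE l))
      ((((bE.coord i (W' a) * bE.coord j (W t b) + bE.coord i (W t a) * bE.coord j (W' b))
            * bE.coord k (W t c) + bE.coord i (W t a) * bE.coord j (W t b) * bE.coord k (W' c))
          * bE.coord l (W t d) + bE.coord i (W t a) * bE.coord j (W t b) * bE.coord k (W t c) * bE.coord l (W' d))
        * rmForm (G t) y (bE i) (bE j) (bE k) (bE l)
        + bE.coord i (W t a) * bE.coord j (W t b) * bE.coord k (W t c) * bE.coord l (W t d) *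
          dRmForm G S t y (bE i) (bE j) (bE k) (bE l)) S' t := fun i j k l ↦
    ((((hco a i).mul (hco b j)).mul (hco c k)).mul (hco d l)).mul (hT i j k l)
  have hsum := HasDerivWithinAt.fun_sum (u := Finset.univ) fun i _ ↦
    HasDerivWithinAt.fun_sum (u := Finset.univ) fun j _ ↦
      HasDerivWithinAt.fun_sum (u := Finset.univ) fun k _ ↦
        HasDerivWithinAt.fun_sum (u := Finset.univ) fun l _ ↦ hterm i j k l
  refine hsum.congr_deriv ?_
  -- regroup the five sums
  rw [hG.dRmForm_eq_sum bE hy htS, rmForm_eq_sum bE y (W' a), rmForm_eq_sum bE y (W t a) (W' b),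
    rmForm_eq_sum bE y (W t a) (W t b) (W' c), rmForm_eq_sum bE y (W t a) (W t b) (W t c) (W' d)]
  simp only [← Finset.sum_add_distrib]
  refine Finset.sum_congr rfl fun i _ ↦ Finset.sum_congr rfl fun j _ ↦
    Finset.sum_congr rfl fun k _ ↦ Finset.sum_congr rfl fun l _ ↦ ?_
  ring

/-! ### Joint continuity of the curvature form and of its time derivative -/

variable [FiniteDimensional ℝ E]

omit [FiniteDimensional ℝ E] in
/-- `(y, t) ↦ Rm_t,y(X,Y,Z,U)` is `C^∞` on `V × S`. [cite: Topping2006, §1.2.3] -/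
theorem contDiffOn_rmForm_family (hG : IsMetricFamilyOn G S V) (X Y Z U : E) :
    ContDiffOn ℝ ∞ (fun q : E × ℝ ↦ rmForm (G q.2) q.1 X Y Z U) (V ×ˢ S) := by
  unfold rmForm
  exact ((hG.contDiffOn.clm_apply ((hG.contDiffOn_riemAt_family X Y).clm_apply contDiffOn_const)).clm_apply
    contDiffOn_const)

omit [FiniteDimensional ℝ E] in
/-- **`∂_t Rm` is jointly continuous** in `(y, t)` on `V × S` at fixed vectors: it is the value
on `(0, 1)` of the derivative within `V × S` of the jointly smooth map `(y, t) ↦ Rm_t,y(X,Y,Z,U)`.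
[cite: Topping2006, §1.2.3] -/
theorem continuousOn_dRmForm_family (hG : IsMetricFamilyOn G S V) (X Y Z U : E) :
    ContinuousOn (fun q : E × ℝ ↦ dRmForm G S q.2 q.1 X Y Z U) (V ×ˢ S) := by
  by_cases hS : S = ∅
  · simp [hS]
  obtain ⟨t₀, ht₀⟩ := Set.nonempty_iff_ne_empty.mpr hS
  have hV := hG.isOpen ht₀
  set F : E × ℝ → ℝ := fun q ↦ rmForm (G q.2) q.1 X Y Z U with hF
  have hFs : ContDiffOn ℝ ∞ F (V ×ˢ S) := hG.contDiffOn_rmForm_family X Y Z U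
  have hQ : UniqueDiffOn ℝ (V ×ˢ S) := UniqueDiffOn.prod hV.uniqueDiffOn hG.uniqueDiffOn
  have hD : ContinuousOn (fun q ↦ fderivWithin ℝ F (V ×ˢ S) q ((0 : E), (1 : ℝ))) (V ×ˢ S) :=
    ((hFs.fderivWithin hQ (m := ∞) (by simp)).continuousOn).clm_apply continuousOn_const
  refine hD.congr fun q hq ↦ ?_
  exact (hasDerivWithinAt_tslice (hFs.differentiableOn (by simp)) hq.1 hq.2).derivWithin
    (hG.uniqueDiffOn q.2 hq.2)

/-- **Joint continuity of the curvature form in the point, the time and the vectors**: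
`(y, t, X, Y, Z, U) ↦ Rm_{t,y}(X,Y,Z,U)` is continuous on `(V × S) × E⁴` (expansion in a basis).
[cite: Topping2006, §1.2.3] -/
theorem continuousOn_rmForm_family₆ (hG : IsMetricFamilyOn G S V) :
    ContinuousOn (fun q : (E × ℝ) × E × E × E × E ↦ rmForm (G q.1.2) q.1.1 q.2.1 q.2.2.1 q.2.2.2.1 q.2.2.2.2)
      ((V ×ˢ S) ×ˢ univ) := by
  set bE := Module.finBasis ℝ E
  have heq : (fun q : (E × ℝ) × E × E × E × E ↦ rmForm (G q.1.2) q.1.1 q.2.1 q.2.2.1 q.2.2.2.1 q.2.2.2.2) =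
      fun q ↦ ∑ i, ∑ j, ∑ k, ∑ l, bE.coord i q.2.1 * bE.coord j q.2.2.1 * bE.coord k q.2.2.2.1 *
        bE.coord l q.2.2.2.2 * rmForm (G q.1.2) q.1.1 (bE i) (bE j) (bE k) (bE l) := by
    funext q; exact rmForm_eq_sum bE _ _ _ _ _
  rw [heq]
  refine continuousOn_finsetSum _ fun i _ ↦ continuousOn_finsetSum _ fun j _ ↦
    continuousOn_finsetSum _ fun k _ ↦ continuousOn_finsetSum _ fun l _ ↦ ?_
  have hc : ∀ m, Continuous fun v : E ↦ bE.coord m v := fun m ↦ (bE.coord m).continuous_of_finiteDimensional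
  refine ((((((hc i).comp_continuousOn continuous_snd.fst.continuousOn).mul
    ((hc j).comp_continuousOn continuous_snd.snd.fst.continuousOn)).mul
    ((hc k).comp_continuousOn continuous_snd.snd.snd.fst.continuousOn)).mul
    ((hc l).comp_continuousOn continuous_snd.snd.snd.snd.continuousOn)).mul ?_)
  exact ((hG.contDiffOn_rmForm_family (bE i) (bE j) (bE k) (bE l)).continuousOn).comp
    continuous_fst.continuousOn (fun q hq ↦ hq.1)

/-- **Joint continuity of `∂_t Rm` in the point, the time and the vectors** on `(V × S) × E⁴`.
[cite: Topping2006, §1.2.3] -/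
theorem continuousOn_dRmForm_family₆ (hG : IsMetricFamilyOn G S V) :
    ContinuousOn (fun q : (E × ℝ) × E × E × E × E ↦
      dRmForm G S q.1.2 q.1.1 q.2.1 q.2.2.1 q.2.2.2.1 q.2.2.2.2) ((V ×ˢ S) ×ˢ univ) := by
  set bE := Module.finBasis ℝ E
  have hc : ∀ m, Continuous fun v : E ↦ bE.coord m v := fun m ↦ (bE.coord m).continuous_of_finiteDimensional
  have hsum : ContinuousOn (fun q : (E × ℝ) × E × E × E × E ↦ ∑ i, ∑ j, ∑ k, ∑ l,
      bE.coord i q.2.1 * bE.coord j q.2.2.1 * bE.coord k q.2.2.2.1 * bE.coord l q.2.2.2.2 *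
        dRmForm G S q.1.2 q.1.1 (bE i) (bE j) (bE k) (bE l)) ((V ×ˢ S) ×ˢ univ) := by
    refine continuousOn_finsetSum _ fun i _ ↦ continuousOn_finsetSum _ fun j _ ↦
      continuousOn_finsetSum _ fun k _ ↦ continuousOn_finsetSum _ fun l _ ↦ ?_
    refine ((((((hc i).comp_continuousOn continuous_snd.fst.continuousOn).mul
      ((hc j).comp_continuousOn continuous_snd.snd.fst.continuousOn)).mul
      ((hc k).comp_continuousOn continuous_snd.snd.snd.fst.continuousOn)).mul
      ((hc l).comp_continuousOn continuous_snd.snd.snd.snd.continuousOn)).mul ?_)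
    exact (hG.continuousOn_dRmForm_family (bE i) (bE j) (bE k) (bE l)).comp
      continuous_fst.continuousOn (fun q hq ↦ hq.1)
  refine hsum.congr fun q hq ↦ ?_
  exact hG.dRmForm_eq_sum bE hq.1.1 hq.1.2 _ _ _ _

end IsMetricFamilyOn

end MetricCoord

end Literature.Geometry.Lorentzian

end
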